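import Literature.IUT.HodgeTheaters.StableCurveTemperedDataOfSpecialFibreLevelQuotientRFDescent
import HarnessLib

/-!
# [IUTchI] Prop. 2.4 (ii) at the genuine 𝔛-datum: the per-level [SemiAnbd] Thm 5.4 (i) binder IN ITS OWN FRAME (any
# open augmentation of `Π^tp_X/admKer_j` killing `π₁^temp(𝒢_j)`), by a finite-index DESCENT of arithmetic ampleness

Mochizuki, *Inter-universal Teichmüller theory I*, kurims manuscript (May 2020), §2, proof of Prop. 2.4 (ii), p. 50 l. 52 –
p. 51 l. 13 ("[SemiAnbd], Theorem 5.4, (ii); [SemiAnbd], Example 5.6") [cite: Mochizuki2012, Prop 2.4(ii) pp.50-51] (D-0012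
claim key; nothing of the series is asserted here), over Mochizuki, *Semi-graphs of anabelioids*, Publ. RIMS **42** (2006),
Prop. 5.2 (iv) p. 64 (`1 → π₁^temp(𝒢) → Π^temp_𝔊 → Π_A → 1`), Def. 5.3 (i) p. 65, Thm. 5.4 (i) p. 66
[cite: MochizukiSemiAnbd2006, Thm 5.4 (i) p.66].  Pages: [IUTchI] = kurims render IUTchI-kurims-url-690e7b3c6199;
[SemiAnbd] = SemiAnbd-kurims-url-f33ace170ff4 (lit/SOURCES.md §0/§11).

PROOF-ONLY file (abc-iut-L5-t11 gen 11, row «HI-LITERAL-FRAME»; no definition, no instance, no new `Prop` fact).  In the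
§2 closers of record (`prop24ii_ofPiData_byName`, one-call `prop24_cor25_ofPiData_byName_noRF`, p467772) the per-level LAW
`hI_j` asks abc-iut-L3's `ArithMaximalCompactStatementI (Dd j) a` for the CANONICAL augmentation `a : Π^tp_j → G_K` of the
level quotient `Π^tp_j := Π^temp_{X_K} ⧸ admKer_j`, whose kernel `Δ^temp_X ⧸ admKer_j` strictly contains
`N̄_j := N_j ⧸ admKer_j = π₁^temp(𝒢_j)` — NOT the frame of [SemiAnbd] §5, where `Ker(Π^temp_𝔊 ↠ Π_A) = π₁^temp(𝒢)`.
Here that law is WEAKENED to Thm 5.4 (i) in its own frame: `ArithMaximalCompactStatementI (Dd j) α_j` for ANY open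
homomorphism `α_j` out of `Π^tp_j` killing `N̄_j` (e.g. `Π^tp_j ↠ Π^tp_j ⧸ N̄_j`, or abc-iut-L3's produced frame
`hexact : ι.range = aug.ker`).  The bridge is elementary (§ A): the conclusion of Thm 5.4 (i) does not mention the
augmentation, and for a COMPACT `K` arithmetic ampleness DESCENDS from `a` to `α_j`, because `K · N̄_j` is closed, of finite
index `≤ [Δ^temp_X : N_j]` (`SpecialFibreTower.N_finiteIndex`) in the open subgroup `K · Ker a = a⁻¹(a(K))`, hence open.  So
NO [SemiAnbd] Ex. 5.6 datum (an open `M_j ≤ Π^temp_{X_K}` with `M_j ∩ Δ^temp_X = N_j`) is needed to consume L3's Thm 5.4 line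
at the genuine datum.  CONDITIONAL as labelled (laws hadm, hI_j^lit, (A3-arith)_j; the one-call also hTF, hNN_i, hab); typed ≠
inhabited ≠ discharged; nothing here asserts that abc is proved or refuted, and nothing here bears on [IUTchIII] Cor. 3.12.
-/

noncomputable section

namespace Literature.IUT.HodgeTheaters

open _root_.Topology
open scoped Pointwise
open Literature.AnabelianGeometry.SemiGraphs Literature.AnabelianGeometry.SemiGraphs.ProfiniteSemiGraph

/-! ### A. Topological group theory: closed subgroups of finite index in an open subgroup; ampleness descent -/

namespace ArithAmpleDescent

variable {G : Type*} [Group G] [TopologicalSpace G] [IsTopologicalGroup G]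

/-- A CLOSED subgroup `H` such that `H ⊔ D` is open for some normal `D` admitting a subgroup `N ≤ H ⊓ D` of
finite index in `D` is OPEN: `H` has finite index in the open subgroup `H ⊔ D = H · D` (the cosets are
represented by `D ⧸ N`), and a closed subgroup of finite index of a topological group is open. [folklore] -/
private theorem isOpen_of_isClosed_of_isOpen_sup (H D N : Subgroup G) [D.Normal] (hNH : N ≤ H)
    (hfin : N.relIndex D ≠ 0) (hH : IsClosed (H : Set G)) (hopen : IsOpen ((H ⊔ D : Subgroup G) : Set G)) :
    IsOpen (H : Set G) := by
  classical
  set L : Subgroup G := H ⊔ D with hL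
  have hHL : H ≤ L := le_sup_left
  have hDL : D ≤ L := le_sup_right
  -- `H` has finite index in `L`: the inclusion `D → L` induces a surjection `D ⧸ (N ⊓ D) ↠ L ⧸ (H ⊓ L)`
  haveI : (N.subgroupOf D).FiniteIndex := ⟨hfin⟩
  let f : D ⧸ N.subgroupOf D → L ⧸ H.subgroupOf L :=
    Quotient.map' (Subgroup.inclusion hDL) fun a b hab => by
      rw [QuotientGroup.leftRel_apply] at hab ⊢
      rw [Subgroup.mem_subgroupOf] at hab ⊢
      change ((a : G)⁻¹ * b) ∈ N at hab
      exact hNH hab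
  have hf : Function.Surjective f := by
    intro q
    induction q using QuotientGroup.induction_on with
    | H x =>
      have hx : (x : G) ∈ ((D ⊔ H : Subgroup G) : Set G) := by
        rw [sup_comm]; exact x.2
      rw [Subgroup.normal_mul] at hx
      obtain ⟨δ, hδ, h, hh, hδh⟩ := Set.mem_mul.mp hx
      refine ⟨QuotientGroup.mk ⟨δ, hδ⟩, ?_⟩
      change QuotientGroup.mk (Subgroup.inclusion hDL ⟨δ, hδ⟩) = QuotientGroup.mk x
      rw [QuotientGroup.eq, Subgroup.mem_subgroupOf]
      change ((δ : G)⁻¹ * x) ∈ H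
      rw [← hδh, ← mul_assoc, inv_mul_cancel, one_mul]
      exact hh
  haveI : Finite (L ⧸ H.subgroupOf L) := Finite.of_surjective f hf
  haveI : (H.subgroupOf L).FiniteIndex := Subgroup.finiteIndex_of_finite_quotient
  -- closed of finite index in the topological group `L` ⇒ open in `L` ⇒ open in `G` (`L` is open)
  have hHL_closed : IsClosed ((H.subgroupOf L : Subgroup L) : Set L) := by
    rw [Subgroup.coe_subgroupOf]
    exact hH.preimage continuous_subtype_val
  have hHL_open : IsOpen ((H.subgroupOf L : Subgroup L) : Set L) :=
    Subgroup.isOpen_of_isClosed_of_finiteIndex _ hHL_closed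
  have himage : ((↑) : L → G) '' ((H.subgroupOf L : Subgroup L) : Set L) = (H : Set G) := by
    ext g
    constructor
    · rintro ⟨x, hx, rfl⟩
      exact Subgroup.mem_subgroupOf.mp hx
    · intro hg
      exact ⟨⟨g, hHL hg⟩, Subgroup.mem_subgroupOf.mpr hg, rfl⟩
  rw [← himage]
  exact hopen.isOpenMap_subtype_val _ hHL_open

variable {Gtp : Type*} [Group Gtp] [TopologicalSpace Gtp] [IsTopologicalGroup Gtp]
  {PA : Type*} [Group PA] [TopologicalSpace PA]
  {PA' : Type*} [Group PA'] [TopologicalSpace PA']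

/-- **Descent of arithmetic ampleness ([SemiAnbd] Def 5.3 (i)) along a change of augmentation with finite-index
kernel gap.**  Let `aug : Π → Π_A` be continuous, `N ⊴ Π` closed with `N ≤ Ker(aug)` of finite index, and
`α : Π → Π'_A` ANY open homomorphism killing `N`.  Then a COMPACT `K ≤ Π` whose `aug`-image is open has open
`α`-image: `K·N` is closed, of finite index in the open subgroup `K·Ker(aug) = aug⁻¹(aug(K))`, hence open, and
`α(K) = α(K·N)`. [cite: MochizukiSemiAnbd2006, Def 5.3 (i), p. 65] -/
theorem isArithAmple_of_isArithAmple_of_isOpenMap {aug : Gtp →* PA} (haug : Continuous aug) {α : Gtp →* PA'}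
    (hα : IsOpenMap α) (N : Subgroup Gtp) [N.Normal] (hNc : IsClosed (N : Set Gtp)) (hNα : N ≤ α.ker)
    (hNaug : N ≤ aug.ker) (hfin : N.relIndex aug.ker ≠ 0) {K : Subgroup Gtp} (hK : IsCompact (K : Set Gtp))
    (hample : IsArithAmple aug K) : IsArithAmple α K := by
  have hHc : IsClosed ((K ⊔ N : Subgroup Gtp) : Set Gtp) := by
    rw [Subgroup.mul_normal]
    exact hNc.mul_left_of_isCompact hK
  -- `H ⊔ Ker(aug) = aug⁻¹(aug(H))` is open, since `aug(H) = aug(K)` is open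
  have hmapH : (K ⊔ N).map aug = K.map aug := by
    rw [Subgroup.map_sup, (Subgroup.map_eq_bot_iff N).mpr hNaug, sup_bot_eq]
  have hopen : IsOpen (((K ⊔ N) ⊔ aug.ker : Subgroup Gtp) : Set Gtp) := by
    rw [← Subgroup.comap_map_eq, Subgroup.coe_comap, hmapH]
    exact hample.preimage haug
  have hHo : IsOpen ((K ⊔ N : Subgroup Gtp) : Set Gtp) :=
    isOpen_of_isClosed_of_isOpen_sup (K ⊔ N) aug.ker N le_sup_right hfin hHc hopen
  have hmapα : (K ⊔ N).map α = K.map α := by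
    rw [Subgroup.map_sup, (Subgroup.map_eq_bot_iff N).mpr hNα, sup_bot_eq]
  unfold IsArithAmple
  rw [← hmapα, Subgroup.coe_map]
  exact hα _ hHo

/-- **[SemiAnbd] Thm 5.4 (i)'s conclusion descends along the same change of augmentation**: its conclusion
(verticial subgroups above `K`, the edge-like meet) does not mention the augmentation, and every compact
`aug`-ample `K` is `α`-ample (`isArithAmple_of_isArithAmple_of_isOpenMap`).  So `ArithMaximalCompactStatementI D α`
for ONE open `α` killing `N` implies `ArithMaximalCompactStatementI D aug`.
[cite: MochizukiSemiAnbd2006, Thm 5.4 (i), p. 66] -/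
theorem arithMaximalCompactStatementI_of_isOpenMap {V B : Type*} (D : DecompositionData Gtp V B)
    {aug : Gtp →* PA} (haug : Continuous aug) {α : Gtp →* PA'} (hα : IsOpenMap α) (N : Subgroup Gtp) [N.Normal]
    (hNc : IsClosed (N : Set Gtp)) (hNα : N ≤ α.ker) (hNaug : N ≤ aug.ker) (hfin : N.relIndex aug.ker ≠ 0)
    (hI : ArithMaximalCompactStatementI D α) : ArithMaximalCompactStatementI D aug :=
  fun K hKc hKa =>
    hI K hKc (isArithAmple_of_isArithAmple_of_isOpenMap haug hα N hNc hNα hNaug hfin hKc hKa)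

end ArithAmpleDescent


/-! ### B. The genuine 𝔛-datum: the §2 binder `hI_j` re-keyed to [SemiAnbd] Thm 5.4 (i)'s OWN frame -/

namespace StableCurveTemperedData

namespace OfSpecialFibre

variable {p : ℕ} [Fact p.Prime] (X : TemperedCurve p)

/-- The level `N_j ≤ Δ^temp_X`, seen in `Π^temp_{X_K}`, is CLOSED: `N_j` is open, hence closed, in `Δ^temp_X`,
and `Δ^temp_X = Ker(Π^temp_{X_K} → G_K)` is closed in `Π^temp_{X_K}` (`G_K` is Hausdorff).
[cite: MochizukiSemiAnbd2006, Ex 3.10 p.44] -/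
theorem isClosed_map_N (T : SpecialFibreTower X.DeltaTemp) (j : ℕ) :
    IsClosed (((T.N j).map X.DeltaTemp.subtype : Subgroup X.PiTemp) : Set X.PiTemp) := by
  have h1 : IsClosed ((T.N j : Subgroup X.DeltaTemp) : Set X.DeltaTemp) :=
    Subgroup.isClosed_of_isOpen _ (T.isOpen_N j)
  -- `Δ^temp_X = Ker(augGK)` is closed: `G_K ≤ G_{ℚ_p}` is Hausdorff
  have hΔ : IsClosed (X.DeltaTemp : Set X.PiTemp) := by
    haveI : IsGalois ℚ_[p] (AlgebraicClosure ℚ_[p]) := {}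
    haveI : T2Space (GQp p) := krullTopology_t2
    rw [← ker_augGK_eq_deltaTemp X, MonoidHom.coe_ker]
    exact isClosed_singleton.preimage X.augGK.continuous
  rw [Subgroup.coe_map]
  exact hΔ.isClosedEmbedding_subtypeVal.isClosedMap _ h1

variable (d : X.GroupLevelData) (T : SpecialFibreTower X.DeltaTemp)
  (Sigma SigmaHat : Set ℕ) (hsub : Sigma ⊆ SigmaHat) (hne : Set.Nonempty Sigma)
  (hprime : ∀ q ∈ SigmaHat, q.Prime)
  (S : SpecialFibreData (X.toTemperedArithmeticGroup d)) (h36 : S.Gc.Prop36Hypotheses)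
  (hp : p ∉ Sigma) (TpH : Subgroup S.chart.G)
  (HatH : Subgroup (TemperedGraphGroupData.exists_completion_of_prop36 S.Gc h36 S.chart).choose)
  (hle : TpH.map (TemperedGraphGroupData.exists_completion_of_prop36 S.Gc h36
    S.chart).choose_spec.choose.toMonoidHom ≤ HatH)
  (cuspMeetsH : {x : X.Pt // X.IsCusp x} → Prop)

/-- **The §2 binder `hI_j` of record is IMPLIED by [SemiAnbd] Thm 5.4 (i) in its own frame.**  At the level-`j`
quotient `Π^tp_j := Π^temp_{X_K} ⧸ admKer_j` of the genuine quotient tower, let `α_j : Π^tp_j → Π'_A` be ANY open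
homomorphism killing the image `N̄_j` of `N_j` (`N̄_j = N_j/admKer_j = π₁^temp(𝒢_j)` via `adm_j`, [SemiAnbd] Ex. 3.10;
the frame of Prop. 5.2 (iv) p. 64: `Ker(Π^temp_𝔊 ↠ Π_A) = π₁^temp(𝒢)`).  If L3's `ArithMaximalCompactStatementI (Dd j) α_j`
holds, then so does `ArithMaximalCompactStatementI (Dd j) a` for the CANONICAL augmentation `a : Π^tp_j → G_K`
(`a ∘ qtp_j = (Π^temp_{X_K} → G_K)`, kernel `Δ^temp_X/admKer_j ⊋ N̄_j`) — the binder `hI` of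
`prop24ii_ofPiData_byName` / `prop24_cor25_ofPiData_byName_noRF` (p467772).  Reason: `N̄_j ⊴ Π^tp_j` is closed of
finite index `[Δ^temp_X : N_j]` (`SpecialFibreTower.N_finiteIndex`) in `Ker a`, so arithmetic ampleness of a compact
subgroup DESCENDS from `a` to `α_j` (`ArithAmpleDescent.arithMaximalCompactStatementI_of_isOpenMap`).
([IUTchI] Prop 2.4(ii) p.51; [SemiAnbd] Thm 5.4 (i) p.66, Prop 5.2 (iv) p.64) [claim: Mochizuki2012, status: disputed] -/
theorem arithStatementI_canonical_of_literal (P : SpecialFibreTower.PiData X d S T)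
    {V B : ℕ → Type*}
    (Dd : ∀ j, DecompositionData ((qTowerOfSpecialFibreTower X T d S h36 Sigma SigmaHat hsub hne hprime hp TpH HatH hle cuspMeetsH P.admKer_normal_pi).Q j).Tp (V j) (B j))
    -- (ii): [SemiAnbd] Thm 5.4 (i) IN ITS OWN FRAME: any open `α_j` out of the level quotient killing `π₁^temp(𝒢_j)`
    {PA : ℕ → Type*} [∀ j, Group (PA j)] [∀ j, TopologicalSpace (PA j)]
    (α : ∀ j, ((qTowerOfSpecialFibreTower X T d S h36 Sigma SigmaHat hsub hne hprime hp TpH HatH hle cuspMeetsH P.admKer_normal_pi).Q j).Tp →* PA j)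
    (hαo : ∀ j, IsOpenMap (α j))
    (hαN : ∀ (j : ℕ) (n : X.DeltaTemp), n ∈ T.N j → α j ((qTowerOfSpecialFibreTower X T d S h36 Sigma SigmaHat hsub hne hprime hp TpH HatH hle cuspMeetsH P.admKer_normal_pi).qtp j (n : X.PiTemp)) = 1)
    (hI : ∀ j, ArithMaximalCompactStatementI (Dd j) (α j))
    (j : ℕ) (a : ((qTowerOfSpecialFibreTower X T d S h36 Sigma SigmaHat hsub hne hprime hp TpH HatH hle cuspMeetsH P.admKer_normal_pi).Q j).Tp →* X.GK)
    (ha : a.comp ((qTowerOfSpecialFibreTower X T d S h36 Sigma SigmaHat hsub hne hprime hp TpH HatH hle cuspMeetsH P.admKer_normal_pi).qtp j) = X.augGK.toMonoidHom) :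
    ArithMaximalCompactStatementI (Dd j) a := by
  haveI hA : (admKerPi X T j).Normal := P.admKer_normal_pi j
  -- `N_j` seen in `Π^temp_{X_K}`: normal (`map_N_normal`), closed (`isClosed_map_N`), `admKer_j ≤ N_j ≤ Δ^temp_X`
  haveI hNPn : ((T.N j).map X.DeltaTemp.subtype).Normal := map_N_normal X T j
  have hAN : admKerPi X T j ≤ (T.N j).map X.DeltaTemp.subtype := admKerPi_le_map_N X T j
  have hNΔ : (T.N j).map X.DeltaTemp.subtype ≤ X.DeltaTemp := Subgroup.map_subtype_le _
  -- the level quotient map `qtp_j = (Π^temp_{X_K} ↠ Π^temp_{X_K} ⧸ admKer_j)`: surjective open quotient map, kernel `admKer_j`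
  have hqsurj : Function.Surjective ((qTowerOfSpecialFibreTower X T d S h36 Sigma SigmaHat hsub hne hprime hp TpH HatH hle cuspMeetsH P.admKer_normal_pi).qtp j) :=
    qTower_qtp_surjective X T d S h36 Sigma SigmaHat hsub hne hprime hp TpH HatH hle cuspMeetsH P.admKer_normal_pi j
  have hq : IsOpenQuotientMap ((qTowerOfSpecialFibreTower X T d S h36 Sigma SigmaHat hsub hne hprime hp TpH HatH hle cuspMeetsH P.admKer_normal_pi).qtp j) := by
    change IsOpenQuotientMap (QuotientGroup.mk' (admKerPi X T j))
    exact QuotientGroup.isOpenQuotientMap_mk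
  have hker : ((qTowerOfSpecialFibreTower X T d S h36 Sigma SigmaHat hsub hne hprime hp TpH HatH hle cuspMeetsH P.admKer_normal_pi).qtp j).ker = admKerPi X T j := by
    change (QuotientGroup.mk' (admKerPi X T j)).ker = _
    exact QuotientGroup.ker_mk' _
  haveI hNn : (((T.N j).map X.DeltaTemp.subtype).map ((qTowerOfSpecialFibreTower X T d S h36 Sigma SigmaHat hsub hne hprime hp TpH HatH hle cuspMeetsH P.admKer_normal_pi).qtp j)).Normal := Subgroup.Normal.map hNPn _ hqsurj
  have hNc : IsClosed (((((T.N j).map X.DeltaTemp.subtype).map ((qTowerOfSpecialFibreTower X T d S h36 Sigma SigmaHat hsub hne hprime hp TpH HatH hle cuspMeetsH P.admKer_normal_pi).qtp j)) :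
      Subgroup ((qTowerOfSpecialFibreTower X T d S h36 Sigma SigmaHat hsub hne hprime hp TpH HatH hle cuspMeetsH P.admKer_normal_pi).Q j).Tp) : Set ((qTowerOfSpecialFibreTower X T d S h36 Sigma SigmaHat hsub hne hprime hp TpH HatH hle cuspMeetsH P.admKer_normal_pi).Q j).Tp) := by
    refine (hq.isQuotientMap.isClosed_preimage).mp ?_
    rw [← Subgroup.coe_comap, Subgroup.comap_map_eq, hker, sup_eq_left.mpr hAN]
    exact isClosed_map_N X T j
  -- the canonical augmentation `a`: continuous, `Ker a = Δ^temp_X/admKer_j`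
  have haug : Continuous a := by
    refine hq.continuous_comp_iff.mp ?_
    have hcoe : (a : ((qTowerOfSpecialFibreTower X T d S h36 Sigma SigmaHat hsub hne hprime hp TpH HatH hle cuspMeetsH P.admKer_normal_pi).Q j).Tp → X.GK) ∘ ((qTowerOfSpecialFibreTower X T d S h36 Sigma SigmaHat hsub hne hprime hp TpH HatH hle cuspMeetsH P.admKer_normal_pi).qtp j) =
        (X.augGK.toMonoidHom : X.PiTemp → X.GK) :=
      congrArg (fun f : X.PiTemp →* X.GK => (f : X.PiTemp → X.GK)) ha
    rw [hcoe]
    exact X.augGK.continuous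
  have hkera : a.ker = X.DeltaTemp.map ((qTowerOfSpecialFibreTower X T d S h36 Sigma SigmaHat hsub hne hprime hp TpH HatH hle cuspMeetsH P.admKer_normal_pi).qtp j) := by
    rw [← Subgroup.map_comap_eq_self_of_surjective hqsurj a.ker, MonoidHom.comap_ker, ha, ker_augGK_eq_deltaTemp]
  have hNα : ((T.N j).map X.DeltaTemp.subtype).map ((qTowerOfSpecialFibreTower X T d S h36 Sigma SigmaHat hsub hne hprime hp TpH HatH hle cuspMeetsH P.admKer_normal_pi).qtp j) ≤ (α j).ker := by
    rintro _ ⟨_, ⟨n, hn, rfl⟩, rfl⟩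
    exact hαN j n hn
  have hNa : ((T.N j).map X.DeltaTemp.subtype).map ((qTowerOfSpecialFibreTower X T d S h36 Sigma SigmaHat hsub hne hprime hp TpH HatH hle cuspMeetsH P.admKer_normal_pi).qtp j) ≤ a.ker := by
    rw [hkera]
    exact Subgroup.map_mono hNΔ
  -- the finite index gap `[Ker a : N̄_j] = [Δ^temp_X : N_j] < ∞`
  have hidx : ((T.N j).map X.DeltaTemp.subtype).relIndex X.DeltaTemp = (T.N j).index := by
    have h := Subgroup.relIndex_map_map_of_injective (T.N j) ⊤ X.DeltaTemp.subtype_injective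
    rw [Subgroup.relIndex_top_right, ← MonoidHom.range_eq_map, Subgroup.range_subtype] at h
    exact h
  have hfin : (((T.N j).map X.DeltaTemp.subtype).map ((qTowerOfSpecialFibreTower X T d S h36 Sigma SigmaHat hsub hne hprime hp TpH HatH hle cuspMeetsH P.admKer_normal_pi).qtp j)).relIndex a.ker ≠ 0 := by
    rw [hkera, Subgroup.relIndex_map_map, hker, sup_eq_left.mpr hAN, sup_eq_left.mpr (hAN.trans hNΔ), hidx]
    exact (T.N_finiteIndex j).index_ne_zero
  exact ArithAmpleDescent.arithMaximalCompactStatementI_of_isOpenMap (Dd j) haug (hαo j)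
    (((T.N j).map X.DeltaTemp.subtype).map ((qTowerOfSpecialFibreTower X T d S h36 Sigma SigmaHat hsub hne hprime hp TpH HatH hle cuspMeetsH P.admKer_normal_pi).qtp j)) hNc hNα hNa hfin (hI j)

/-- **[IUTchI] Prop. 2.4 (ii) AS TYPED at the genuine 𝔛-datum over `P`, the per-level Thm 5.4 (i) binder in
[SemiAnbd]'s OWN FRAME** — `prop24ii_ofPiData_byName` (p467772) with its LAW `hI_j` («`ArithMaximalCompactStatementI
(Dd j) a` for the canonical `a : Π^tp_j → G_K`», kernel `Δ^temp_X/admKer_j ⊋ π₁^temp(𝒢_j)`) REPLACED by the strictly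
weaker `hI_j^lit`: «`ArithMaximalCompactStatementI (Dd j) (α j)` for ANY open homomorphism `α_j` out of `Π^tp_j` killing
`N_j/admKer_j = π₁^temp(𝒢_j)`» = Thm 5.4 (i) p. 66 in the frame of Prop 5.2 (iv) p. 64 (`Ker(Π^temp_𝔊 ↠ Π_A) =
π₁^temp(𝒢)`; here `Π_A := Π^tp_j ⧸ N̄_j`, or the codomain of any such `α_j`) — the literal output type of abc-iut-L3's
`arithMaximalCompactStatementI_and_II_ofChartAt … (hexact : ι.range = aug.ker)`.  Laws: `hadm`, `hI_j^lit`, (A3-arith)_j;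
data: per-level `DecompositionData`, the frames `α_j`, nodes with tempered branch conjugators.  NO [SemiAnbd] Ex. 5.6
datum `M_j` (open subgroup with `M_j ∩ Δ = N_j`) is needed.
([IUTchI] Prop 2.4(ii) pp.50-51; [SemiAnbd] Thm 5.4 (i) p.66) [claim: Mochizuki2012, status: disputed] -/
theorem prop24ii_ofPiData_byName_literal (P : SpecialFibreTower.PiData X d S T)
    (hadm : ∀ U ∈ 𝓝 (1 : ↥X.DeltaTemp), ∃ j, ((T.admKer j : Subgroup ↥X.DeltaTemp) : Set ↥X.DeltaTemp) ⊆ U)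
    {V B : ℕ → Type*}
    (Dd : ∀ j, DecompositionData ((qTowerOfSpecialFibreTower X T d S h36 Sigma SigmaHat hsub hne hprime hp TpH HatH hle cuspMeetsH P.admKer_normal_pi).Q j).Tp (V j) (B j))
    -- (ii): [SemiAnbd] Thm 5.4 (i) IN ITS OWN FRAME: any open `α_j` out of the level quotient killing `π₁^temp(𝒢_j)`
    {PA : ℕ → Type*} [∀ j, Group (PA j)] [∀ j, TopologicalSpace (PA j)]
    (α : ∀ j, ((qTowerOfSpecialFibreTower X T d S h36 Sigma SigmaHat hsub hne hprime hp TpH HatH hle cuspMeetsH P.admKer_normal_pi).Q j).Tp →* PA j)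
    (hαo : ∀ j, IsOpenMap (α j))
    (hαN : ∀ (j : ℕ) (n : X.DeltaTemp), n ∈ T.N j → α j ((qTowerOfSpecialFibreTower X T d S h36 Sigma SigmaHat hsub hne hprime hp TpH HatH hle cuspMeetsH P.admKer_normal_pi).qtp j (n : X.PiTemp)) = 1)
    (hI : ∀ j, ArithMaximalCompactStatementI (Dd j) (α j))
    {E : ℕ → Type*} (src tgt : ∀ j, E j → V j)
    (c₁ c₂ : ∀ j, E j → ((qTowerOfSpecialFibreTower X T d S h36 Sigma SigmaHat hsub hne hprime hp TpH HatH hle cuspMeetsH P.admKer_normal_pi).Q j).Tp)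
    (hA3 : ∀ (j : ℕ) (Λ : Subgroup X.PiTemp), IsCompact (Λ : Set X.PiTemp) → Λ ≠ ⊥ →
      IsOpen (Λ.map X.augGK.toMonoidHom : Set X.GK) →
      ∀ (v w : V j) (g h γ : ((qTowerOfSpecialFibreTower X T d S h36 Sigma SigmaHat hsub hne hprime hp TpH HatH hle cuspMeetsH P.admKer_normal_pi).Q j).Hat),
        MulAut.conj γ • Λ.map (((qTowerOfSpecialFibreTower X T d S h36 Sigma SigmaHat hsub hne hprime hp TpH HatH hle cuspMeetsH P.admKer_normal_pi).qhat j).comp X.toHat.toMonoidHom) ≤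
            MulAut.conj g • ((Dd j).vertGp v).map ((qTowerOfSpecialFibreTower X T d S h36 Sigma SigmaHat hsub hne hprime hp TpH HatH hle cuspMeetsH P.admKer_normal_pi).Q j).ι →
        MulAut.conj γ • Λ.map (((qTowerOfSpecialFibreTower X T d S h36 Sigma SigmaHat hsub hne hprime hp TpH HatH hle cuspMeetsH P.admKer_normal_pi).qhat j).comp X.toHat.toMonoidHom) ≤
            MulAut.conj h • ((Dd j).vertGp w).map ((qTowerOfSpecialFibreTower X T d S h36 Sigma SigmaHat hsub hne hprime hp TpH HatH hle cuspMeetsH P.admKer_normal_pi).Q j).ι →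
          (v = w ∧ g⁻¹ * h ∈ ((Dd j).vertGp v).map ((qTowerOfSpecialFibreTower X T d S h36 Sigma SigmaHat hsub hne hprime hp TpH HatH hle cuspMeetsH P.admKer_normal_pi).Q j).ι) ∨
          (∃ (e : E j) (k : ((qTowerOfSpecialFibreTower X T d S h36 Sigma SigmaHat hsub hne hprime hp TpH HatH hle cuspMeetsH P.admKer_normal_pi).Q j).Hat),
            ∃ p ∈ ((Dd j).vertGp (src j e)).map ((qTowerOfSpecialFibreTower X T d S h36 Sigma SigmaHat hsub hne hprime hp TpH HatH hle cuspMeetsH P.admKer_normal_pi).Q j).ι,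
            ∃ q ∈ ((Dd j).vertGp (tgt j e)).map ((qTowerOfSpecialFibreTower X T d S h36 Sigma SigmaHat hsub hne hprime hp TpH HatH hle cuspMeetsH P.admKer_normal_pi).Q j).ι,
            (src j e = v ∧ tgt j e = w ∧
                g = k * ((qTowerOfSpecialFibreTower X T d S h36 Sigma SigmaHat hsub hne hprime hp TpH HatH hle cuspMeetsH P.admKer_normal_pi).Q j).ι (c₁ j e) * p ∧
                h = k * ((qTowerOfSpecialFibreTower X T d S h36 Sigma SigmaHat hsub hne hprime hp TpH HatH hle cuspMeetsH P.admKer_normal_pi).Q j).ι (c₂ j e) * q) ∨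
            (src j e = w ∧ tgt j e = v ∧
                h = k * ((qTowerOfSpecialFibreTower X T d S h36 Sigma SigmaHat hsub hne hprime hp TpH HatH hle cuspMeetsH P.admKer_normal_pi).Q j).ι (c₁ j e) * p ∧
                g = k * ((qTowerOfSpecialFibreTower X T d S h36 Sigma SigmaHat hsub hne hprime hp TpH HatH hle cuspMeetsH P.admKer_normal_pi).Q j).ι (c₂ j e) * q)) ∨
          (∃ (u : V j) (f : ((qTowerOfSpecialFibreTower X T d S h36 Sigma SigmaHat hsub hne hprime hp TpH HatH hle cuspMeetsH P.admKer_normal_pi).Q j).Hat),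
            (∃ (e : E j) (k : ((qTowerOfSpecialFibreTower X T d S h36 Sigma SigmaHat hsub hne hprime hp TpH HatH hle cuspMeetsH P.admKer_normal_pi).Q j).Hat),
              ∃ p ∈ ((Dd j).vertGp (src j e)).map ((qTowerOfSpecialFibreTower X T d S h36 Sigma SigmaHat hsub hne hprime hp TpH HatH hle cuspMeetsH P.admKer_normal_pi).Q j).ι,
              ∃ q ∈ ((Dd j).vertGp (tgt j e)).map ((qTowerOfSpecialFibreTower X T d S h36 Sigma SigmaHat hsub hne hprime hp TpH HatH hle cuspMeetsH P.admKer_normal_pi).Q j).ι,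
              (src j e = v ∧ tgt j e = u ∧
                  g = k * ((qTowerOfSpecialFibreTower X T d S h36 Sigma SigmaHat hsub hne hprime hp TpH HatH hle cuspMeetsH P.admKer_normal_pi).Q j).ι (c₁ j e) * p ∧
                  f = k * ((qTowerOfSpecialFibreTower X T d S h36 Sigma SigmaHat hsub hne hprime hp TpH HatH hle cuspMeetsH P.admKer_normal_pi).Q j).ι (c₂ j e) * q) ∨
              (src j e = u ∧ tgt j e = v ∧
                  f = k * ((qTowerOfSpecialFibreTower X T d S h36 Sigma SigmaHat hsub hne hprime hp TpH HatH hle cuspMeetsH P.admKer_normal_pi).Q j).ι (c₁ j e) * p ∧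
                  g = k * ((qTowerOfSpecialFibreTower X T d S h36 Sigma SigmaHat hsub hne hprime hp TpH HatH hle cuspMeetsH P.admKer_normal_pi).Q j).ι (c₂ j e) * q)) ∧
            (∃ (e : E j) (k : ((qTowerOfSpecialFibreTower X T d S h36 Sigma SigmaHat hsub hne hprime hp TpH HatH hle cuspMeetsH P.admKer_normal_pi).Q j).Hat),
              ∃ p ∈ ((Dd j).vertGp (src j e)).map ((qTowerOfSpecialFibreTower X T d S h36 Sigma SigmaHat hsub hne hprime hp TpH HatH hle cuspMeetsH P.admKer_normal_pi).Q j).ι,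
              ∃ q ∈ ((Dd j).vertGp (tgt j e)).map ((qTowerOfSpecialFibreTower X T d S h36 Sigma SigmaHat hsub hne hprime hp TpH HatH hle cuspMeetsH P.admKer_normal_pi).Q j).ι,
              (src j e = u ∧ tgt j e = w ∧
                  f = k * ((qTowerOfSpecialFibreTower X T d S h36 Sigma SigmaHat hsub hne hprime hp TpH HatH hle cuspMeetsH P.admKer_normal_pi).Q j).ι (c₁ j e) * p ∧
                  h = k * ((qTowerOfSpecialFibreTower X T d S h36 Sigma SigmaHat hsub hne hprime hp TpH HatH hle cuspMeetsH P.admKer_normal_pi).Q j).ι (c₂ j e) * q) ∨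
              (src j e = w ∧ tgt j e = u ∧
                  h = k * ((qTowerOfSpecialFibreTower X T d S h36 Sigma SigmaHat hsub hne hprime hp TpH HatH hle cuspMeetsH P.admKer_normal_pi).Q j).ι (c₁ j e) * p ∧
                  f = k * ((qTowerOfSpecialFibreTower X T d S h36 Sigma SigmaHat hsub hne hprime hp TpH HatH hle cuspMeetsH P.admKer_normal_pi).Q j).ι (c₂ j e) * q)))) :
    (ofSpecialFibre X d S h36 Sigma SigmaHat hsub hne hprime hp TpH HatH hle cuspMeetsH).Prop24ii :=
  prop24ii_ofPiData_byName X d T Sigma SigmaHat hsub hne hprime S h36 hp TpH HatH hle cuspMeetsH P hadm Dd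
    (fun j a ha => arithStatementI_canonical_of_literal X d T Sigma SigmaHat hsub hne hprime S h36 hp TpH HatH hle
      cuspMeetsH P Dd α hαo hαN hI j a ha)
    src tgt c₁ c₂ hA3

/-- **[IUTchI] Prop. 2.4 (i)(ii)(iii) ∧ Cor. 2.5 AS TYPED at the genuine 𝔛-datum over `P`, ONE CALL, the per-level
Thm 5.4 (i) binder in [SemiAnbd]'s OWN FRAME** — the one-call `prop24_cor25_ofPiData_byName_noRF` (p467772) with
`hI_j` REPLACED by `hI_j^lit` (see `prop24ii_ofPiData_byName_literal`).  LAW list: hTF ([Config] Rmk 1.2.2 printed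
form) · hNN_i (F-2540) · hab · hadm · hI_j^lit ([SemiAnbd] Thm 5.4 (i) for ANY open augmentation of `Π^tp_j` killing
`π₁^temp(𝒢_j)`) · hA3ar_j = 6; data/side conditions as there, plus the frames `α_j`.
([IUTchI] Prop 2.4, Cor 2.5 pp.50-51; [SemiAnbd] Thm 5.4 (i) p.66) [claim: Mochizuki2012, status: disputed] -/
theorem prop24_cor25_ofPiData_byName_noRF_literal (P : SpecialFibreTower.PiData X d S T) (x : {x : X.Pt // X.IsCusp x})
    -- (i): [Config] Rmk 1.2.2, printed form on `X.DeltaHat`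
    (hTF : ∀ H : Subgroup X.DeltaHat, IsOpen (H : Set X.DeltaHat) →
      ∀ (h : H) (n : ℕ), n ≠ 0 →
        SigmaCharDetects Set.univ H h → SigmaCharDetects Set.univ H (h ^ n))
    -- (i): per-level PSC data with (A3) := F-2540 BY NAME and the identification side conditions
    (G : ∀ i, PSCDatum (levelGraph X T Sigma SigmaHat hsub hne hprime i).Hat)
    (hNN : ∀ i, (G i).VerticialIntersectionNear)
    (σ : ∀ i, (T.Gc i).graph.Vertex ≃ (G i).graph.V) (Λv : ∀ i, (G i).graph.V → Subgroup (T.chart i).G)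
    (hvert : ∀ i (v : (T.Gc i).graph.Vertex), Λv i (σ i v) ∈ verticialSubgroups (T.chart i) v)
    (hΛv : ∀ i v, (Λv i v).map (levelGraph X T Sigma SigmaHat hsub hne hprime i).ι = (G i).vertGp v)
    (src tgt : ∀ i, (G i).graph.N → (G i).graph.V) (c₁ c₂ : ∀ i, (G i).graph.N → (T.chart i).G)
    (hends : ∀ i e, (G i).graph.nodeEnds e = s(src i e, tgt i e))
    (h₁ : ∀ i e, (G i).nodeGp e ≤
      MulAut.conj ((levelGraph X T Sigma SigmaHat hsub hne hprime i).ι (c₁ i e)) • (G i).vertGp (src i e))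
    (h₂ : ∀ i e, (G i).nodeGp e ≤
      MulAut.conj ((levelGraph X T Sigma SigmaHat hsub hne hprime i).ι (c₂ i e)) • (G i).vertGp (tgt i e))
    (hloop : ∀ i e, src i e = tgt i e → (c₁ i e)⁻¹ * c₂ i e ∉ Λv i (src i e))
    -- (i): the pro-`Σ` abelianization law along the admissible quotients
    (hab : ∀ (i : ℕ) (A : Type) [CommGroup A] [Finite A] (χ : T.N i →* A),
      IsOpen ((χ.ker : Subgroup (T.N i)) : Set (T.N i)) →
      (∀ q : ℕ, q.Prime → q ∣ Nat.card A → q ∈ Sigma) → (T.adm i).toMonoidHom.ker ≤ χ.ker)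
    -- (i)(ii): the admissible kernels shrink to `1`
    (hadm : ∀ U ∈ 𝓝 (1 : ↥X.DeltaTemp), ∃ j, ((T.admKer j : Subgroup ↥X.DeltaTemp) : Set ↥X.DeltaTemp) ⊆ U)
    -- (ii): per-level arithmetic decomposition data, node data, (A3-arith)_j
    {V B : ℕ → Type*}
    (Dd : ∀ j, DecompositionData ((qTowerOfSpecialFibreTower X T d S h36 Sigma SigmaHat hsub hne hprime hp TpH HatH hle cuspMeetsH P.admKer_normal_pi).Q j).Tp (V j) (B j))
    -- (ii): [SemiAnbd] Thm 5.4 (i) IN ITS OWN FRAME: any open `α_j` out of the level quotient killing `π₁^temp(𝒢_j)`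
    {PA : ℕ → Type*} [∀ j, Group (PA j)] [∀ j, TopologicalSpace (PA j)]
    (α : ∀ j, ((qTowerOfSpecialFibreTower X T d S h36 Sigma SigmaHat hsub hne hprime hp TpH HatH hle cuspMeetsH P.admKer_normal_pi).Q j).Tp →* PA j)
    (hαo : ∀ j, IsOpenMap (α j))
    (hαN : ∀ (j : ℕ) (n : X.DeltaTemp), n ∈ T.N j → α j ((qTowerOfSpecialFibreTower X T d S h36 Sigma SigmaHat hsub hne hprime hp TpH HatH hle cuspMeetsH P.admKer_normal_pi).qtp j (n : X.PiTemp)) = 1)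
    (hI : ∀ j, ArithMaximalCompactStatementI (Dd j) (α j))
    {EA : ℕ → Type*} (srcA tgtA : ∀ j, EA j → V j)
    (c₁A c₂A : ∀ j, EA j → ((qTowerOfSpecialFibreTower X T d S h36 Sigma SigmaHat hsub hne hprime hp TpH HatH hle cuspMeetsH P.admKer_normal_pi).Q j).Tp)
    (hA3ar : ∀ (j : ℕ) (Λ : Subgroup X.PiTemp), IsCompact (Λ : Set X.PiTemp) → Λ ≠ ⊥ →
      IsOpen (Λ.map X.augGK.toMonoidHom : Set X.GK) →
      ∀ (v w : V j) (g h γ : ((qTowerOfSpecialFibreTower X T d S h36 Sigma SigmaHat hsub hne hprime hp TpH HatH hle cuspMeetsH P.admKer_normal_pi).Q j).Hat),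
        MulAut.conj γ • Λ.map (((qTowerOfSpecialFibreTower X T d S h36 Sigma SigmaHat hsub hne hprime hp TpH HatH hle cuspMeetsH P.admKer_normal_pi).qhat j).comp X.toHat.toMonoidHom) ≤
            MulAut.conj g • ((Dd j).vertGp v).map ((qTowerOfSpecialFibreTower X T d S h36 Sigma SigmaHat hsub hne hprime hp TpH HatH hle cuspMeetsH P.admKer_normal_pi).Q j).ι →
        MulAut.conj γ • Λ.map (((qTowerOfSpecialFibreTower X T d S h36 Sigma SigmaHat hsub hne hprime hp TpH HatH hle cuspMeetsH P.admKer_normal_pi).qhat j).comp X.toHat.toMonoidHom) ≤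
            MulAut.conj h • ((Dd j).vertGp w).map ((qTowerOfSpecialFibreTower X T d S h36 Sigma SigmaHat hsub hne hprime hp TpH HatH hle cuspMeetsH P.admKer_normal_pi).Q j).ι →
          (v = w ∧ g⁻¹ * h ∈ ((Dd j).vertGp v).map ((qTowerOfSpecialFibreTower X T d S h36 Sigma SigmaHat hsub hne hprime hp TpH HatH hle cuspMeetsH P.admKer_normal_pi).Q j).ι) ∨
          (∃ (e : EA j) (k : ((qTowerOfSpecialFibreTower X T d S h36 Sigma SigmaHat hsub hne hprime hp TpH HatH hle cuspMeetsH P.admKer_normal_pi).Q j).Hat),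
            ∃ p ∈ ((Dd j).vertGp (srcA j e)).map ((qTowerOfSpecialFibreTower X T d S h36 Sigma SigmaHat hsub hne hprime hp TpH HatH hle cuspMeetsH P.admKer_normal_pi).Q j).ι,
            ∃ q ∈ ((Dd j).vertGp (tgtA j e)).map ((qTowerOfSpecialFibreTower X T d S h36 Sigma SigmaHat hsub hne hprime hp TpH HatH hle cuspMeetsH P.admKer_normal_pi).Q j).ι,
            (srcA j e = v ∧ tgtA j e = w ∧
                g = k * ((qTowerOfSpecialFibreTower X T d S h36 Sigma SigmaHat hsub hne hprime hp TpH HatH hle cuspMeetsH P.admKer_normal_pi).Q j).ι (c₁A j e) * p ∧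
                h = k * ((qTowerOfSpecialFibreTower X T d S h36 Sigma SigmaHat hsub hne hprime hp TpH HatH hle cuspMeetsH P.admKer_normal_pi).Q j).ι (c₂A j e) * q) ∨
            (srcA j e = w ∧ tgtA j e = v ∧
                h = k * ((qTowerOfSpecialFibreTower X T d S h36 Sigma SigmaHat hsub hne hprime hp TpH HatH hle cuspMeetsH P.admKer_normal_pi).Q j).ι (c₁A j e) * p ∧
                g = k * ((qTowerOfSpecialFibreTower X T d S h36 Sigma SigmaHat hsub hne hprime hp TpH HatH hle cuspMeetsH P.admKer_normal_pi).Q j).ι (c₂A j e) * q)) ∨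
          (∃ (u : V j) (f : ((qTowerOfSpecialFibreTower X T d S h36 Sigma SigmaHat hsub hne hprime hp TpH HatH hle cuspMeetsH P.admKer_normal_pi).Q j).Hat),
            (∃ (e : EA j) (k : ((qTowerOfSpecialFibreTower X T d S h36 Sigma SigmaHat hsub hne hprime hp TpH HatH hle cuspMeetsH P.admKer_normal_pi).Q j).Hat),
              ∃ p ∈ ((Dd j).vertGp (srcA j e)).map ((qTowerOfSpecialFibreTower X T d S h36 Sigma SigmaHat hsub hne hprime hp TpH HatH hle cuspMeetsH P.admKer_normal_pi).Q j).ι,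
              ∃ q ∈ ((Dd j).vertGp (tgtA j e)).map ((qTowerOfSpecialFibreTower X T d S h36 Sigma SigmaHat hsub hne hprime hp TpH HatH hle cuspMeetsH P.admKer_normal_pi).Q j).ι,
              (srcA j e = v ∧ tgtA j e = u ∧
                  g = k * ((qTowerOfSpecialFibreTower X T d S h36 Sigma SigmaHat hsub hne hprime hp TpH HatH hle cuspMeetsH P.admKer_normal_pi).Q j).ι (c₁A j e) * p ∧
                  f = k * ((qTowerOfSpecialFibreTower X T d S h36 Sigma SigmaHat hsub hne hprime hp TpH HatH hle cuspMeetsH P.admKer_normal_pi).Q j).ι (c₂A j e) * q) ∨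
              (srcA j e = u ∧ tgtA j e = v ∧
                  f = k * ((qTowerOfSpecialFibreTower X T d S h36 Sigma SigmaHat hsub hne hprime hp TpH HatH hle cuspMeetsH P.admKer_normal_pi).Q j).ι (c₁A j e) * p ∧
                  g = k * ((qTowerOfSpecialFibreTower X T d S h36 Sigma SigmaHat hsub hne hprime hp TpH HatH hle cuspMeetsH P.admKer_normal_pi).Q j).ι (c₂A j e) * q)) ∧
            (∃ (e : EA j) (k : ((qTowerOfSpecialFibreTower X T d S h36 Sigma SigmaHat hsub hne hprime hp TpH HatH hle cuspMeetsH P.admKer_normal_pi).Q j).Hat),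
              ∃ p ∈ ((Dd j).vertGp (srcA j e)).map ((qTowerOfSpecialFibreTower X T d S h36 Sigma SigmaHat hsub hne hprime hp TpH HatH hle cuspMeetsH P.admKer_normal_pi).Q j).ι,
              ∃ q ∈ ((Dd j).vertGp (tgtA j e)).map ((qTowerOfSpecialFibreTower X T d S h36 Sigma SigmaHat hsub hne hprime hp TpH HatH hle cuspMeetsH P.admKer_normal_pi).Q j).ι,
              (srcA j e = u ∧ tgtA j e = w ∧
                  f = k * ((qTowerOfSpecialFibreTower X T d S h36 Sigma SigmaHat hsub hne hprime hp TpH HatH hle cuspMeetsH P.admKer_normal_pi).Q j).ι (c₁A j e) * p ∧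
                  h = k * ((qTowerOfSpecialFibreTower X T d S h36 Sigma SigmaHat hsub hne hprime hp TpH HatH hle cuspMeetsH P.admKer_normal_pi).Q j).ι (c₂A j e) * q) ∨
              (srcA j e = w ∧ tgtA j e = u ∧
                  h = k * ((qTowerOfSpecialFibreTower X T d S h36 Sigma SigmaHat hsub hne hprime hp TpH HatH hle cuspMeetsH P.admKer_normal_pi).Q j).ι (c₁A j e) * p ∧
                  f = k * ((qTowerOfSpecialFibreTower X T d S h36 Sigma SigmaHat hsub hne hprime hp TpH HatH hle cuspMeetsH P.admKer_normal_pi).Q j).ι (c₂A j e) * q)))) :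
    ((ofSpecialFibre X d S h36 Sigma SigmaHat hsub hne hprime hp TpH HatH hle cuspMeetsH).Prop24i ∧
      (ofSpecialFibre X d S h36 Sigma SigmaHat hsub hne hprime hp TpH HatH hle cuspMeetsH).Prop24ii ∧
      (ofSpecialFibre X d S h36 Sigma SigmaHat hsub hne hprime hp TpH HatH hle cuspMeetsH).Prop24iii) ∧
    ((ofSpecialFibre X d S h36 Sigma SigmaHat hsub hne hprime hp TpH HatH hle cuspMeetsH).Cor25Decomposition ∧
      (ofSpecialFibre X d S h36 Sigma SigmaHat hsub hne hprime hp TpH HatH hle cuspMeetsH).Cor25Inertia) :=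
  prop24_cor25_ofPiData_byName_noRF X d T Sigma SigmaHat hsub hne hprime S h36 hp TpH HatH hle cuspMeetsH P x hTF G hNN
    σ Λv hvert hΛv src tgt c₁ c₂ hends h₁ h₂ hloop hab hadm Dd
    (fun j a ha => arithStatementI_canonical_of_literal X d T Sigma SigmaHat hsub hne hprime S h36 hp TpH HatH hle
      cuspMeetsH P Dd α hαo hαN hI j a ha)
    srcA tgtA c₁A c₂A hA3ar

end OfSpecialFibre

end StableCurveTemperedData

end Literature.IUT.HodgeTheaters

end
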